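import Mathlib
import Summits.NavierStokesRegularity.NavierStokesRegularity.Theorems.ThreadingFluxHorizonTowerQuadraticGeneratorOcticBrackets
import Summits.NavierStokesRegularity.NavierStokesRegularity.Theorems.ThreadingFluxHorizonTowerTwoFourSixDigits
import Summits.NavierStokesRegularity.NavierStokesRegularity.Theorems.ThreadingFluxHorizonTowerFiniteTowerThreeShell
import HarnessLib

/-!
# Crux `PoloidalLiouville` (stmt-NavierStokesRegularity-1222), crux idea «horizon-threading-tower» (ns-idea-15):
# FINITE TOWERS AT ORDER ONE — THM F: THE TOWER `{2, 6, 8}` IS COAXIALLY ZONAL (second cone digit)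

Support file (`--supports stmt-NavierStokesRegularity-1222`, helper; cell `ns-wall-extremal`, width hand ns-wall-eng-3 g5; 0 kit).

The tower `{2, 6, 8}` has one parity and a non-coprime top pair `(6, 8) = 2·(3, 4)`; its third degree `2` is neither coprime-isolated
(THM C″) nor `D′ − 2 = 4`.  The null-cone digit makes the top shells `c₁ · 77π₆(L³)`, `c₂ · 2145π₈(L⁴)` for one harmonic quadratic
generator `L = xᵀQx` (degree-two chart surjectivity, chart injectivity, two-power reality `…QuadraticGeneratorOctic`); since the competitors
of the top pair enter the class identity `5{P₆,P₈} + 11ρ²{P₂,P₈} + 6ρ³{P₂,P₆} = 0` only at `ρ²`, the SECOND digit of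
`{B, C} = ρW(−288288 L⁴ + ρR)` must vanish on the cone: `chartT W · (chartT L)⁴ = 0`, so the harmonic cubic `W = det(x, Qx, Q²x)` is zero,
`{L, M} = 4W = 0`, same-degree rigidity (p684047) gives `M − (τ/3)ρ ∥ L`, the uniaxial lemma gives the axis, and THM A descends.

* ★★ `finiteTower_exists_axis_of_twoSixEight` (polynomial level), ★★ `finiteTower_zonal_of_twoSixEight` (`A ∈ 𝓗₂` possibly zero,
  `B ∈ 𝓗₆`, `C ∈ 𝓗₈` non-zero ⇒ one common axis), `finiteTower_zonalForm_of_twoSixEight`.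

HONEST LABEL: one more cell of the crux-idea CONJECTURE `HorizonTowerZonality` at ORDER ONE (the second all-one-parity, non-coprime-top
cell); `{2,4,8}`, `{4,6,8}`, `{1,3,9}`, … and the general tower stay OPEN; `PoloidalLiouville` (1222), `UnthreadedRigidity` (27585) OPEN;
W1 movement 0; NS regularity NOT proved.  [folklore]
-/

-- the summit and its single sub-problem share the name (CONVENTIONS §1)
set_option linter.dupNamespace false

noncomputable section

open MvPolynomial Complex
open scoped Polynomial RealInnerProductSpace
open Literature.Analysis.FluidPDE (cross)

namespace Summit.NavierStokesRegularity.NavierStokesRegularity.Theorems.PoloidalLiouville.HorizonTower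

/-! ### Polynomial level -/

/-- ★★ **THM F, polynomial level.**  In a scale-free tower `U_{H₂} + U_{H₆} + U_{H₈}` of horizon profiles annihilated by the order-one
horizon law off the centre, with polynomial models `P₆, P₈ ≠ 0`, the top shell is annihilated by the rotation derivative about some real
axis `n ≠ 0`. [folklore] -/
theorem finiteTower_exists_axis_of_twoSixEight (H : ℕ → E3 → ℝ)
    (hH : ∀ l ∈ ({2, 6, 8} : Finset ℕ), ContDiff ℝ (⊤ : ℕ∞) (H l))
    (hhom : ∀ l ∈ ({2, 6, 8} : Finset ℕ), ∀ (c : ℝ) (y : E3), H l (c • y) = c ^ l * H l y)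
    (hharm : ∀ l ∈ ({2, 6, 8} : Finset ℕ), ∀ y, Laplacian.laplacian (H l) y = 0)
    (hL1 : ∀ x : E3, x ≠ 0 → horizonL1 (fun z => ∑ l ∈ ({2, 6, 8} : Finset ℕ), horizonProfile l (H l) 0 z) 0 x = 0)
    (P : ℕ → MvPolynomial (Fin 3) ℝ)
    (hP : ∀ l ∈ ({2, 6, 8} : Finset ℕ), (P l).IsHomogeneous l ∧ Zonal.lapP (P l) = 0 ∧ ∀ y, H l y = Zonal.evalE (P l) y)
    (hP6 : P 6 ≠ 0) (hP8 : P 8 ≠ 0) :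
    ∃ n : Fin 3 → ℝ, n ≠ 0 ∧ Zonal.detP (C (n 0) * X 0 + C (n 1) * X 1 + C (n 2) * X 2) (P 8) = 0 := by
  classical
  have hK : ∀ l ∈ ({2, 6, 8} : Finset ℕ), 1 ≤ l := by
    intro l hl; simp only [Finset.mem_insert, Finset.mem_singleton] at hl; omega
  have h2K : (2 : ℕ) ∈ ({2, 6, 8} : Finset ℕ) := by simp
  have h6K : (6 : ℕ) ∈ ({2, 6, 8} : Finset ℕ) := by simp
  have h8K : (8 : ℕ) ∈ ({2, 6, 8} : Finset ℕ) := by simp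
  have hρ0 : (Zonal.normSq : Zonal.RPoly) ≠ 0 := Zonal.rho_ne_zero
  -- the class identity
  have hE := finiteTower_classIdentity_twoSixEight H hH hhom hharm hL1 P (fun l hl => (hP l hl).2.2)
  -- the top pair: weighted Wronskian law `6 f g′ = 8 g f′`
  set f : ℂ[X] := Zonal.chartT (map (algebraMap ℝ ℂ) (P 6)) with hf
  set g : ℂ[X] := Zonal.chartT (map (algebraMap ℝ ℂ) (P 8)) with hg
  have hW := finiteTower_top_wronskian {2, 6, 8} H hK hH hhom hharm hL1 P (fun l hl => ⟨(hP l hl).1, (hP l hl).2.2⟩) h8K h6K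
    (by norm_num) (by intro l hl; simp only [Finset.mem_insert, Finset.mem_singleton] at hl; omega)
    (by intro l hl hl8; simp only [Finset.mem_insert, Finset.mem_singleton] at hl; omega)
  have hW' : (3 : ℂ[X]) * f * Polynomial.derivative g = (4 : ℂ[X]) * g * Polynomial.derivative f := by
    have h2 : (2 : ℂ[X]) * ((3 : ℂ[X]) * f * Polynomial.derivative g - (4 : ℂ[X]) * g * Polynomial.derivative f) = 0 := by
      rw [← hf, ← hg] at hW
      linear_combination hW
    exact sub_eq_zero.mp ((mul_eq_zero.mp h2).resolve_left two_ne_zero)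
  have hWr := Zonal.wronskian_pow_pow_eq_zero (a := 3) (b := 4) (by norm_num) (by norm_num)
    (by exact_mod_cast hW')
  have hg0 : g ≠ 0 := fun h => hP8 (Zonal.eq_zero_of_chartT_map_eq_zero (hP 8 h8K).1 (hP 8 h8K).2.1 h)
  have hf0 : f ≠ 0 := fun h => hP6 (Zonal.eq_zero_of_chartT_map_eq_zero (hP 6 h6K).1 (hP 6 h6K).2.1 h)
  obtain ⟨c, hc⟩ := Zonal.exists_C_mul_of_wronskian_eq_zero (pow_ne_zero _ hg0) hWr
  set lc : ℂ := g.leadingCoeff with hlc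
  obtain ⟨q, hqm, hgq, hdeg⟩ := Zonal.exists_monic_eq_C_mul_pow_of_coprime (a := 4) (b := 3) (by decide) (by norm_num) hf0 hc
  rw [← hlc] at hgq
  have hq0 : q ≠ 0 := hqm.ne_zero
  have hq4 : q.natDegree ≤ 4 := by
    have h1 : g.natDegree ≤ 2 * 8 := Zonal.natDegree_chartT_le (((hP 8 h8K).1).map (algebraMap ℝ ℂ))
    omega
  -- `f = γ q³`
  have hf4 : f ^ 4 = Polynomial.C (c * lc ^ 3) * (q ^ 3) ^ 4 := by
    rw [hc, hgq, mul_pow, ← Polynomial.C_pow, ← mul_assoc, ← Polynomial.C_mul]; ring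
  obtain ⟨γ, hγ⟩ := Zonal.exists_eq_C_mul_pow_of_pow_eq (D := 4) (d := 3) (by norm_num) hq0 hf4
  -- `q` is the chart of a complex generator
  obtain ⟨qa, qb, qd, qe, qf, hgen⟩ := Zonal.exists_gen_chartT_eq hq4
  rw [← hgen] at hγ hgq
  have hP6c : map (algebraMap ℝ ℂ) (P 6) = C (γ / 77) * Zonal.genB qa qb qd qe qf :=
    Zonal.eq_C_mul_genB_of_chartT_eq qa qb qd qe qf (((hP 6 h6K).1).map _)
      (by rw [← Zonal.map_lapP, (hP 6 h6K).2.1, map_zero]) hγ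
  have hP8c : map (algebraMap ℝ ℂ) (P 8) = C (lc / 2145) * Zonal.genC qa qb qd qe qf :=
    Zonal.eq_C_mul_genC_of_chartT_eq qa qb qd qe qf (((hP 8 h8K).1).map _)
      (by rw [← Zonal.map_lapP, (hP 8 h8K).2.1, map_zero]) hgq
  -- reality of the generator (two-power form)
  obtain ⟨w, ra, rb, rd, re, rf, hwa, hwb, hwd, hwe, hwf⟩ := Zonal.exists_real_gen_of_map_eq_C_mul_genB_genC hP6 hP8 hP6c hP8c
  rw [hwa, hwb, hwd, hwe, hwf] at hP6c hP8c hgen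
  have hmapB : map (algebraMap ℝ ℂ) (Zonal.genB ra rb rd re rf) = Zonal.genB (ra : ℂ) rb rd re rf := by
    rw [Zonal.map_genB]; rfl
  have hmapC : map (algebraMap ℝ ℂ) (Zonal.genC ra rb rd re rf) = Zonal.genC (ra : ℂ) rb rd re rf := by
    rw [Zonal.map_genC]; rfl
  have hmapL : map (algebraMap ℝ ℂ) (Zonal.genL ra rb rd re rf) = Zonal.genL (ra : ℂ) rb rd re rf := by
    rw [Zonal.map_genL]; rfl
  rw [Zonal.genB_smul, ← mul_assoc, ← map_mul, ← hmapB] at hP6c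
  rw [Zonal.genC_smul, ← mul_assoc, ← map_mul, ← hmapC] at hP8c
  have hB0 : Zonal.genB ra rb rd re rf ≠ 0 := by
    intro h0
    rw [h0, map_zero, mul_zero, map_eq_zero_iff _ (map_injective (algebraMap ℝ ℂ) (RCLike.ofReal_injective))] at hP6c
    exact hP6 hP6c
  have hC0 : Zonal.genC ra rb rd re rf ≠ 0 := by
    intro h0
    rw [h0, map_zero, mul_zero, map_eq_zero_iff _ (map_injective (algebraMap ℝ ℂ) (RCLike.ofReal_injective))] at hP8c
    exact hP8 hP8c
  obtain ⟨c₁, hc₁⟩ := LoopLaw.exists_real_smul_of_map_eq_C_mul hB0 hP6c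
  obtain ⟨c₂, hc₂⟩ := LoopLaw.exists_real_smul_of_map_eq_C_mul hC0 hP8c
  rw [smul_eq_C_mul] at hc₁ hc₂
  have hc₁0 : c₁ ≠ 0 := by rintro rfl; exact hP6 (by rw [hc₁, C_0, zero_mul])
  have hc₂0 : c₂ ≠ 0 := by rintro rfl; exact hP8 (by rw [hc₂, C_0, zero_mul])
  have hL0 : Zonal.genL ra rb rd re rf ≠ 0 := by
    intro h0
    apply hq0
    rw [← hgen, Zonal.genL_smul, ← hmapL, h0, map_zero, mul_zero, Zonal.chartT_zero]
  -- the second digit: `W · L⁴` dies on the cone, hence `W = 0`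
  set L := Zonal.genL ra rb rd re rf with hLdef
  set M := Zonal.genM ra rb rd re rf with hMdef
  set W := Zonal.genW ra rb rd re rf with hWdef
  rw [hc₁, hc₂] at hE
  have hexp : C 5 * Zonal.detP (C c₁ * Zonal.genB ra rb rd re rf) (C c₂ * Zonal.genC ra rb rd re rf)
      + C 11 * Zonal.normSq ^ 2 * Zonal.detP (P 2) (C c₂ * Zonal.genC ra rb rd re rf)
      + C 6 * Zonal.normSq ^ 3 * Zonal.detP (P 2) (C c₁ * Zonal.genB ra rb rd re rf)
      = Zonal.normSq * (C (-(1441440 * c₁ * c₂)) * W * L ^ 4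
        + Zonal.normSq * (C (5 * c₁ * c₂) * W * (-(C 177408 * L ^ 2 * M) - C 354816 * Zonal.normSq * M ^ 2
          + C (118272 * Zonal.genTau ra rb rd re rf) * Zonal.normSq * L ^ 2
          + C (107520 * Zonal.genTau ra rb rd re rf) * Zonal.normSq ^ 2 * M
          + C (258048 * Zonal.genDelta ra rb rd re rf) * Zonal.normSq ^ 2 * L
          - C (8064 * Zonal.genTau ra rb rd re rf ^ 2) * Zonal.normSq ^ 3)
          + C (11 * c₂) * Zonal.detP (P 2) (Zonal.genC ra rb rd re rf)
          + Zonal.normSq * (C (6 * c₁) * Zonal.detP (P 2) (Zonal.genB ra rb rd re rf)))) := by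
    rw [Zonal.detP_C_mul_right, Zonal.detP_C_mul_left, Zonal.detP_genB_genC, Zonal.detP_C_mul_right, Zonal.detP_C_mul_right]
    simp only [map_mul, map_neg, map_ofNat]
    ring
  rw [hexp] at hE
  have hT := (mul_eq_zero.mp hE).resolve_left hρ0
  have hWchart : Zonal.chartT (map (algebraMap ℝ ℂ) W) = 0 := by
    have h1 := congrArg (fun p : Zonal.RPoly => Zonal.chartT (map (algebraMap ℝ ℂ) p)) hT
    simp only [map_add, map_mul, map_pow, Zonal.map_normSq, Zonal.chartT_add, Zonal.chartT_mul, Zonal.chartT_pow,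
      Zonal.chartT_normSq, zero_mul, add_zero, map_zero, Zonal.chartT_zero, map_C, Zonal.chartT_C] at h1
    have hLc : Zonal.chartT (map (algebraMap ℝ ℂ) L) ≠ 0 := fun h0 =>
      hL0 (Zonal.eq_zero_of_chartT_map_eq_zero (Zonal.isHomogeneous_genL ra rb rd re rf) (Zonal.lapP_genL ra rb rd re rf) h0)
    have hconst : (Polynomial.C ((algebraMap ℝ ℂ) (-(1441440 * c₁ * c₂))) : ℂ[X]) ≠ 0 := by
      rw [Ne, Polynomial.C_eq_zero, map_eq_zero_iff _ (RCLike.ofReal_injective)]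
      exact neg_ne_zero.mpr (mul_ne_zero (mul_ne_zero (by norm_num) hc₁0) hc₂0)
    rcases mul_eq_zero.mp h1 with h2 | h2
    · rcases mul_eq_zero.mp h2 with h3 | h3
      · exact absurd h3 hconst
      · exact h3
    · exact absurd h2 (pow_ne_zero 4 hLc)
  have hW0 : W = 0 :=
    Zonal.eq_zero_of_chartT_map_eq_zero (Zonal.isHomogeneous_genW ra rb rd re rf) (Zonal.lapP_genW ra rb rd re rf) hWchart
  -- `{L, M₀} = 0` and same-degree rigidity
  set M₀ : Zonal.RPoly := M - C (Zonal.genTau ra rb rd re rf / 3) * Zonal.normSq with hM₀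
  have hM₀h : M₀.IsHomogeneous 2 := (Zonal.isHomogeneous_genM ra rb rd re rf).sub (Zonal.isHomogeneous_normSq.C_mul _)
  have hM₀l : Zonal.lapP M₀ = 0 := by
    rw [hM₀, Zonal.lapP_sub, Zonal.lapP_C_mul, Zonal.lapP_genM, Zonal.lapP_normSq, ← map_mul, ← map_sub,
      show 2 * Zonal.genTau ra rb rd re rf - Zonal.genTau ra rb rd re rf / 3 * 6 = 0 by ring, map_zero]
  have hbr : Zonal.detP L M₀ = 0 := by
    rw [hM₀, Zonal.detP_sub_right, Zonal.detP_C_mul_right, Zonal.detP_normSq_right, mul_zero, sub_zero,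
      Zonal.detP_genL_genM, ← hWdef, hW0, mul_zero]
  obtain ⟨β, hβ⟩ := LoopLaw.sameDegreeBracketRigidity 2 L M₀ (by norm_num)
    ⟨Zonal.isHomogeneous_genL ra rb rd re rf, Zonal.laplacian_eval_eq_zero_of_lapP (Zonal.lapP_genL ra rb rd re rf)⟩
    ⟨hM₀h, Zonal.laplacian_eval_eq_zero_of_lapP hM₀l⟩ hL0 (Zonal.bracket_eval_eq_zero_of_detP hbr)
  have hM : Zonal.genM ra rb rd re rf = C β * Zonal.genL ra rb rd re rf + C (Zonal.genTau ra rb rd re rf / 3) * Zonal.normSq := by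
    rw [← smul_eq_C_mul, ← hβ, hM₀]; ring
  -- the uniaxial lemma
  obtain ⟨n, hn, hrot⟩ := Zonal.exists_axis_of_genM_eq ra rb rd re rf hM
  refine ⟨n, hn, ?_⟩
  rw [hc₂, Zonal.detP_C_mul_right, Zonal.detP_genC_right, hM, Zonal.detP_add_right, Zonal.detP_C_mul_right,
    Zonal.detP_C_mul_right, Zonal.detP_normSq_right, hrot]
  ring

/-! ### ★★ THM F -/

/-- The three-shell sum over `K = {2, 6, 8}`. [folklore] -/
theorem twoSixEight_sum_eq (A B Cc : E3 → ℝ) (z : E3) :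
    ∑ k ∈ ({2, 6, 8} : Finset ℕ), horizonProfile k ((fun k => if k = 8 then Cc else if k = 6 then B else A) k) 0 z
      = horizonProfile 2 A 0 z + horizonProfile 6 B 0 z + horizonProfile 8 Cc 0 z :=
  threeShell_sum_eq (l := 2) (m := 6) (n := 8) (by norm_num) (by norm_num) (by norm_num) A B Cc z

/-- ★★ **THM F — THE TOWER `{2, 6, 8}` IS COAXIALLY ZONAL AT ORDER ONE.**  Let `A ∈ 𝓗₂` (possibly zero), `B ∈ 𝓗₆`, `C ∈ 𝓗₈` be smooth
homogeneous harmonic shells with `B, C ≢ 0`.  If the scale-free tower `U_A + U_B + U_C` of their horizon profiles is annihilated by the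
order-one horizon law `𝔏₁` off the centre, then the three shells are zonal about ONE common axis `a ≠ 0`. [folklore] -/
theorem finiteTower_zonal_of_twoSixEight {A B Cc : E3 → ℝ}
    (hA : ContDiff ℝ (⊤ : ℕ∞) A) (hhomA : ∀ (c : ℝ) (y : E3), A (c • y) = c ^ 2 * A y) (hharmA : ∀ y, Laplacian.laplacian A y = 0)
    (hB : ContDiff ℝ (⊤ : ℕ∞) B) (hhomB : ∀ (c : ℝ) (y : E3), B (c • y) = c ^ 6 * B y) (hharmB : ∀ y, Laplacian.laplacian B y = 0)
    (hC : ContDiff ℝ (⊤ : ℕ∞) Cc) (hhomC : ∀ (c : ℝ) (y : E3), Cc (c • y) = c ^ 8 * Cc y)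
    (hharmC : ∀ y, Laplacian.laplacian Cc y = 0) (hB0 : ∃ y, B y ≠ 0) (hC0 : ∃ y, Cc y ≠ 0)
    (hL1 : ∀ x : E3, x ≠ 0 →
      horizonL1 (fun z => horizonProfile 2 A 0 z + horizonProfile 6 B 0 z + horizonProfile 8 Cc 0 z) 0 x = 0) :
    ∃ a : E3, a ≠ 0 ∧ (∀ y : E3, ⟪cross a y, gradient A y⟫ = 0) ∧ (∀ y : E3, ⟪cross a y, gradient B y⟫ = 0) ∧
      (∀ y : E3, ⟪cross a y, gradient Cc y⟫ = 0) := by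
  classical
  set K : Finset ℕ := {2, 6, 8} with hKdef
  set Hs : ℕ → E3 → ℝ := fun k => if k = 8 then Cc else if k = 6 then B else A with hHs
  have hH2 : Hs 2 = A := by simp [hHs]
  have hH6 : Hs 6 = B := by simp [hHs]
  have hH8 : Hs 8 = Cc := by simp [hHs]
  have hmem : ∀ k ∈ K, k = 2 ∨ k = 6 ∨ k = 8 := fun k hk => by simpa [hKdef] using hk
  have hK1 : ∀ k ∈ K, 1 ≤ k := by intro k hk; rcases hmem k hk with rfl | rfl | rfl <;> norm_num
  have hHs' : ∀ k ∈ K, ContDiff ℝ (⊤ : ℕ∞) (Hs k) := by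
    intro k hk; rcases hmem k hk with rfl | rfl | rfl
    · rw [hH2]; exact hA
    · rw [hH6]; exact hB
    · rw [hH8]; exact hC
  have hhom' : ∀ k ∈ K, ∀ (c : ℝ) (y : E3), Hs k (c • y) = c ^ k * Hs k y := by
    intro k hk; rcases hmem k hk with rfl | rfl | rfl
    · rw [hH2]; exact hhomA
    · rw [hH6]; exact hhomB
    · rw [hH8]; exact hhomC
  have hharm' : ∀ k ∈ K, ∀ y, Laplacian.laplacian (Hs k) y = 0 := by
    intro k hk; rcases hmem k hk with rfl | rfl | rfl
    · rw [hH2]; exact hharmA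
    · rw [hH6]; exact hharmB
    · rw [hH8]; exact hharmC
  have hL1' : ∀ x : E3, x ≠ 0 → horizonL1 (fun z => ∑ k ∈ K, horizonProfile k (Hs k) 0 z) 0 x = 0 := by
    intro x hx
    have hfun : (fun z => ∑ k ∈ K, horizonProfile k (Hs k) 0 z)
        = fun z => horizonProfile 2 A 0 z + horizonProfile 6 B 0 z + horizonProfile 8 Cc 0 z :=
      funext fun z => twoSixEight_sum_eq A B Cc z
    rw [hfun]; exact hL1 x hx
  obtain ⟨P, hP⟩ := finiteTower_exists_polys K Hs hHs' hhom' hharm'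
  have hne : ∀ {l}, l ∈ K → (∃ y, Hs l y ≠ 0) → P l ≠ 0 := by
    intro l hl ⟨y, hy⟩ h
    apply hy
    rw [(hP l hl).2.2 y, h]
    simp [Zonal.evalE]
  have h6K : (6 : ℕ) ∈ K := by simp [hKdef]
  have h8K : (8 : ℕ) ∈ K := by simp [hKdef]
  have hP6 : P 6 ≠ 0 := hne h6K (by rw [hH6]; exact hB0)
  have hP8 : P 8 ≠ 0 := hne h8K (by rw [hH8]; exact hC0)
  obtain ⟨n, hn, htop⟩ := finiteTower_exists_axis_of_twoSixEight Hs hHs' hhom' hharm' hL1' P hP hP6 hP8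
  have hmax : ∀ k ∈ K, k ≤ 8 := by intro k hk; rcases hmem k hk with rfl | rfl | rfl <;> omega
  have hall := finiteTower_detP_lin_eq_zero_of_top K Hs hK1 hHs' hhom' hharm' hL1' P hP h8K hmax hP8 hn htop
  have hna : (WithLp.toLp 2 n : E3) ≠ 0 := by
    intro h
    apply hn
    funext i
    have := congrArg (fun v : E3 => v i) h
    simpa using this
  have conv : ∀ {l}, l ∈ K → ∀ y : E3, ⟪cross (WithLp.toLp 2 n) y, gradient (Hs l) y⟫ = 0 := by
    intro l hl y
    have h := hall l hl
    rw [Zonal.detP_lin_eq_zero_iff] at h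
    have := h y
    rwa [← show Hs l = Zonal.evalE (P l) from funext (hP l hl).2.2] at this
  refine ⟨WithLp.toLp 2 n, hna, ?_, ?_, ?_⟩
  · have := conv (by simp [hKdef] : (2 : ℕ) ∈ K); rwa [hH2] at this
  · have := conv h6K; rwa [hH6] at this
  · have := conv h8K; rwa [hH8] at this

/-- THM F with the ZONAL FUNCTIONAL FORMS of the Defs twin as conclusion. [folklore] -/
theorem finiteTower_zonalForm_of_twoSixEight {A B Cc : E3 → ℝ}
    (hA : ContDiff ℝ (⊤ : ℕ∞) A) (hhomA : ∀ (c : ℝ) (y : E3), A (c • y) = c ^ 2 * A y) (hharmA : ∀ y, Laplacian.laplacian A y = 0)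
    (hB : ContDiff ℝ (⊤ : ℕ∞) B) (hhomB : ∀ (c : ℝ) (y : E3), B (c • y) = c ^ 6 * B y) (hharmB : ∀ y, Laplacian.laplacian B y = 0)
    (hC : ContDiff ℝ (⊤ : ℕ∞) Cc) (hhomC : ∀ (c : ℝ) (y : E3), Cc (c • y) = c ^ 8 * Cc y)
    (hharmC : ∀ y, Laplacian.laplacian Cc y = 0) (hB0 : ∃ y, B y ≠ 0) (hC0 : ∃ y, Cc y ≠ 0)
    (hL1 : ∀ x : E3, x ≠ 0 →
      horizonL1 (fun z => horizonProfile 2 A 0 z + horizonProfile 6 B 0 z + horizonProfile 8 Cc 0 z) 0 x = 0) :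
    ∃ (a : E3) (gA gB gC : ℝ → ℝ), a ≠ 0 ∧
      (∀ y : E3, y ≠ 0 → A y = ‖y‖ ^ 2 * gA (⟪a, y⟫ / ‖y‖)) ∧
      (∀ y : E3, y ≠ 0 → B y = ‖y‖ ^ 6 * gB (⟪a, y⟫ / ‖y‖)) ∧
      (∀ y : E3, y ≠ 0 → Cc y = ‖y‖ ^ 8 * gC (⟪a, y⟫ / ‖y‖)) := by
  obtain ⟨a, ha, hAa, hBa, hCa⟩ := finiteTower_zonal_of_twoSixEight hA hhomA hharmA hB hhomB hharmB hC hhomC hharmC hB0 hC0 hL1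
  obtain ⟨gA, hgA⟩ := exists_zonalForm_of_inner_cross_gradient_eq_zero (l := 2) ha (hA.differentiable (by simp))
    (fun c y _ => hhomA c y) hAa
  obtain ⟨gB, hgB⟩ := exists_zonalForm_of_inner_cross_gradient_eq_zero (l := 6) ha (hB.differentiable (by simp))
    (fun c y _ => hhomB c y) hBa
  obtain ⟨gC, hgC⟩ := exists_zonalForm_of_inner_cross_gradient_eq_zero (l := 8) ha (hC.differentiable (by simp))
    (fun c y _ => hhomC c y) hCa
  exact ⟨a, gA, gB, gC, ha, hgA, hgB, hgC⟩

end Summit.NavierStokesRegularity.NavierStokesRegularity.Theorems.PoloidalLiouville.HorizonTower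

end
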